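import Summits.QuantumFields.YangMills.Theorems.SmallFieldWideningLargeFieldMassRefinementTailUnitTop

/-!
# Route `SmallFieldWidening`, crux r3 `LargeFieldMassRefinementTail` (stmt-QuantumFields-22884), line `birth` v6 — THE SHARED STUB `stub_firstExitDeep`
# (= crux `FirstExitWindowTailL`, stmt-QuantumFields-26243) HOLDS AT EVERY BOUNDED HEIGHT `j ≤ j₀`, UNIFORMLY IN THE VOLUME AND IN THE RUN:
# iterated box-locality of the (0.4) averaging + the bare single-plaquette tail; the open content of the stub is exactly `j → ∞`
# (support file; width seat `ym-line-sfw-p2-w2` gen 17; the stub, both cruxes and rung R3 stay OPEN)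

WHY.  The tree proves large-plaquette tails of block-averaged fields at bounded height in two flavours: `HistoryTailBoundedHeight` (every height `j ≤ j₀`, but with
a constant `∝ L^{3m}` — a union over the whole torus, so NOT uniform in the family) and `FirstExitWindow.stub_firstExitOne` (p614089; height `1` only, VOLUME-UNIFORM,
by box-locality `exists_blame_finset`).  The registered stub of the two cruxes asks for constants uniform in the family at EVERY height `j ≥ 2`.  This file iterates the
box-locality blame `j` times and records, as a kernel theorem, that the stub's bound holds for all heights `j ≤ j₀` with constants depending on `(L, b₀, p₀, j₀)` ONLY:

* §1 ★ `exists_blame_finset_iter` (every level count `k ≤ m + K`, `SU(2)`, the printed smearing `ℰp`): for every plaquette `p` of `T^{(k)}` there is a set `S` of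
  BARE plaquettes with `|S| ≤ B^k`, `B = L² + 45L³`, such that for every bare field `U` and `a ≥ 0` below the guard at every intermediate level,
  «every `q ∈ S` has `|U(∂q) − 1| ≤ a`» forces `|Ū^k(∂p) − 1| ≤ W₀^k·a`, `W₀ = L² + 6(5L)²` (induction on `k` over `exists_blame_finset`).
* §2 `beta_height` — `β_K = L^j·β_{K−j}` and `β_K·θ(K−j)² = L^j·p(g_{K−j})²`.
* §3 ★★ `firstExitDeep_boundedHeight j₀` — the stub's text with the extra binder `j ≤ j₀` (and `j ≤ K` in place of `2 ≤ j ≤ K`: heights `0` and `1` included), PROVED: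
  witnesses `γ₁ = γ_θ(L, b₀, p₀)` (all thresholds below `δ_{SU(2)}/(5L)²`), `N = 5`, `c = (L/W²)^{j₀}/16` (`W = W₀ + 1`), `C = B^{j₀}·2e^{24}c₀⁻³·L^{5j₀}` — no volume, no `K`.
  The Gaussian constant degrades geometrically in `j₀` (`L/W² < 1`): that, and only that, is why `j₀ ↛ ∞` here ([Balaban1985UV3] (71) is the `j`-uniform statement).
* §4 `unitTop_boundedRuns j₀` — via the companion normal form (`…UnitTop.gibbsK_real_firstExit_eq_refine`): the window-free unit-top tail holds for all runs of
  length `K ≤ j₀`, uniformly in the family («short runs are free»).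

WHAT THIS IS NOT.  Not the stub (unbounded height), nothing about the Yang–Mills mass gap; rung R3 is a RECORD rung; cruxes 22884 / 26243 stay open.

References: T. Bałaban, CMP **98** (1985) 17–51 [Balaban1985Averaging] (Prop. 1 (51) p.26, p.25); CMP **102** (1985) 255–275 [Balaban1985UV3] ((7) p.257, (11) p.258,
(71) p.273); [FrohlichIsraelLiebSimon1978] Thm 4.1 (engine of the bare tail).
-/

set_option autoImplicit false

noncomputable section

open MeasureTheory
open scoped BigOperators

namespace Summit.QuantumFields.YangMills.Theorems.FirstExitDeepBoundedHeight

open Literature.MathematicalPhysics.QuantumFieldTheory.Balaban1983to89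
open Literature.MathematicalPhysics.QuantumFieldTheory.Balaban1983to89.T3ContinuumYM3Torus
open Literature.MathematicalPhysics.QuantumFieldTheory.Balaban1983to89.T3UnitScaleTilt
open Literature.MathematicalPhysics.QuantumFieldTheory.Balaban1983to89.T3UnitLawDensityEML (ℰp)
open Literature.MathematicalPhysics.QuantumFieldTheory.Balaban1983to89.ExpMeanLog (expMeanLogSU deltaSU deltaSU_pos)
open Literature.MathematicalPhysics.QuantumFieldTheory.Balaban1983to89.BlockAveraging (avgFun)
open Literature.MathematicalPhysics.QuantumFieldTheory.Balaban1983to89.T3Thresholds (exists_gamma_forall_θBal_le)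
open Literature.MathematicalPhysics.QuantumFieldTheory.Balaban1983to89.T3MinimiserStabilityReduction (θBal_pos)
open Literature.MathematicalPhysics.QuantumFieldTheory.Balaban1983to89.T3FinestHeightTail (gibbsMeasure_real_dist1_ge_le)
open Summit.QuantumFields.YangMills.Theorems.FirstExitWindow (exists_blame_finset)

/-! ## §1 Iterated box-locality: `Ū^k(∂p)` is controlled by `≤ B^k` bare plaquettes -/

section Blame

variable {P : Params}

/-- ★ **THE ITERATED BLAMED NEIGHBOURHOOD** (`SU(2)`, printed smearing; every `k ≤ m + K`): for every plaquette `p` of `T^{(k)}` there is a finite set `S` of BARE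
plaquettes, `|S| ≤ (L² + 5·d²·L^d)^k` — INDEPENDENT of the volume — such that for every bare configuration `U` and every `a ≥ 0` with the (0.4) guard
`(((d+2)L)²/4)·(W₀^i a) < δ_{SU(2)}` at every intermediate level `i < k` (`W₀ = L² + 6((d+2)L)²`): if every `q ∈ S` has `|U(∂q) − 1| ≤ a` then `|Ū^k(∂p) − 1| ≤ W₀^k·a`.
Induction on `k` over the one-step `exists_blame_finset`. [cite: Balaban1985Averaging, Prop. 1 (51) p.26 and p.25] -/
theorem exists_blame_finset_iter : ∀ (k : ℕ), k ≤ P.m + P.K → ∀ p : Plaq P k,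
    ∃ S : Finset (Plaq P 0), (S.card : ℝ) ≤ ((P.L : ℝ) ^ 2 + 5 * ((P.L : ℝ) ^ P.d * (P.d : ℝ) ^ 2)) ^ k ∧
      ∀ (U : GaugeField P 0 (Matrix.specialUnitaryGroup (Fin 2) ℂ)) (a : ℝ), 0 ≤ a →
        (∀ i, i < k → ((((P.d + 2) * P.L : ℕ) : ℝ) ^ 2 / 4) *
          (((P.L : ℝ) ^ 2 + 6 * (((P.d + 2) * P.L : ℕ) : ℝ) ^ 2) ^ i * a) < deltaSU (Fin 2)) →
        (∀ q ∈ S, dist1 (GaugeField.plaqHol U q) ≤ a) →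
        dist1 (GaugeField.plaqHol (Averaging.iter (fun i => BlockAveraging.blockAvg (P := P) (j := i) ℰp) k U) p) ≤
          ((P.L : ℝ) ^ 2 + 6 * (((P.d + 2) * P.L : ℕ) : ℝ) ^ 2) ^ k * a
  | 0, _, p => by
    classical
    refine ⟨{p}, by simp, fun U a _ _ hS => ?_⟩
    rw [pow_zero, one_mul]
    exact hS p (Finset.mem_singleton_self p)
  | k + 1, hk, p => by
    classical
    obtain ⟨S₁, hS₁card, hS₁dom⟩ := exists_blame_finset (n := Fin 2) hk p
    have ih := fun q : Plaq P k => exists_blame_finset_iter k (Nat.le_of_succ_le hk) q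
    choose Sq hSqcard hSqdom using ih
    refine ⟨S₁.biUnion Sq, ?_, fun U a ha hguard hS => ?_⟩
    · -- the count `|⋃_{q ∈ S₁} S_q| ≤ |S₁|·B^k ≤ B^{k+1}`
      have hB0 : (0 : ℝ) ≤ (P.L : ℝ) ^ 2 + 5 * ((P.L : ℝ) ^ P.d * (P.d : ℝ) ^ 2) := by positivity
      calc ((S₁.biUnion Sq).card : ℝ) ≤ ((∑ q ∈ S₁, (Sq q).card : ℕ) : ℝ) := by exact_mod_cast Finset.card_biUnion_le
        _ = ∑ q ∈ S₁, ((Sq q).card : ℝ) := by push_cast; rfl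
        _ ≤ ∑ _q ∈ S₁, ((P.L : ℝ) ^ 2 + 5 * ((P.L : ℝ) ^ P.d * (P.d : ℝ) ^ 2)) ^ k := Finset.sum_le_sum fun q _ => hSqcard q
        _ = S₁.card * ((P.L : ℝ) ^ 2 + 5 * ((P.L : ℝ) ^ P.d * (P.d : ℝ) ^ 2)) ^ k := by rw [Finset.sum_const, nsmul_eq_mul]
        _ ≤ ((P.L : ℝ) ^ 2 + 5 * ((P.L : ℝ) ^ P.d * (P.d : ℝ) ^ 2)) * ((P.L : ℝ) ^ 2 + 5 * ((P.L : ℝ) ^ P.d * (P.d : ℝ) ^ 2)) ^ k :=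
            mul_le_mul_of_nonneg_right hS₁card (pow_nonneg hB0 k)
        _ = ((P.L : ℝ) ^ 2 + 5 * ((P.L : ℝ) ^ P.d * (P.d : ℝ) ^ 2)) ^ (k + 1) := by ring
    · -- the domination: the level-`k` plaquettes of `S₁` are `W₀^k a`-small by induction, then one more (0.4) step
      have hW0 : (0 : ℝ) ≤ (P.L : ℝ) ^ 2 + 6 * (((P.d + 2) * P.L : ℕ) : ℝ) ^ 2 := by positivity
      have hk' : ∀ q ∈ S₁, dist1 (GaugeField.plaqHol (Averaging.iter (fun i => BlockAveraging.blockAvg (P := P) (j := i) ℰp) k U) q) ≤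
          ((P.L : ℝ) ^ 2 + 6 * (((P.d + 2) * P.L : ℕ) : ℝ) ^ 2) ^ k * a := fun q hq =>
        hSqdom q U a ha (fun i hi => hguard i (Nat.lt_succ_of_lt hi))
          (fun q' hq' => hS q' (Finset.mem_biUnion.mpr ⟨q, hq, hq'⟩))
      have hstep := hS₁dom (Averaging.iter (fun i => BlockAveraging.blockAvg (P := P) (j := i) ℰp) k U)
        (((P.L : ℝ) ^ 2 + 6 * (((P.d + 2) * P.L : ℕ) : ℝ) ^ 2) ^ k * a) (mul_nonneg (pow_nonneg hW0 k) ha)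
        (hguard k (Nat.lt_succ_self k)) hk'
      calc dist1 (GaugeField.plaqHol (Averaging.iter (fun i => BlockAveraging.blockAvg (P := P) (j := i) ℰp) (k + 1) U) p)
          = dist1 (GaugeField.plaqHol (avgFun (expMeanLogSU (n := Fin 2))
              (Averaging.iter (fun i => BlockAveraging.blockAvg (P := P) (j := i) ℰp) k U)) p) := rfl
        _ ≤ ((P.L : ℝ) ^ 2 + 6 * (((P.d + 2) * P.L : ℕ) : ℝ) ^ 2) *
              (((P.L : ℝ) ^ 2 + 6 * (((P.d + 2) * P.L : ℕ) : ℝ) ^ 2) ^ k * a) := hstep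
        _ = ((P.L : ℝ) ^ 2 + 6 * (((P.d + 2) * P.L : ℕ) : ℝ) ^ 2) ^ (k + 1) * a := by ring

end Blame

/-! ## §2 Height arithmetic -/

section Arith

/-- **Height arithmetic at height `j ≤ K`**: `β_K = L^j·β_{K−j}` and `β_K·θ_{b₀}(K−j)² = L^j·p(g_{K−j})²`. [cite: Balaban1985UV3, (3)-(7) pp.256-257] -/
theorem beta_height (F : T3Family) {γ : ℝ} (hγ : 0 < γ) (b₀ p₀ : ℝ) {K j : ℕ} (hjK : j ≤ K) :
    (F.scheme ℰp γ).β K = (F.L : ℝ) ^ j * (γ * ((F.L : ℝ)⁻¹) ^ (K - j))⁻¹ ∧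
      (F.scheme ℰp γ).β K * θBal F.L γ b₀ p₀ (K - j) ^ 2 =
        (F.L : ℝ) ^ j * B10.pFun b₀ p₀ (Real.sqrt (γ * ((F.L : ℝ)⁻¹) ^ (K - j))) ^ 2 := by
  have hL : (0 : ℝ) < F.L := by exact_mod_cast lt_trans zero_lt_one F.hL.2
  obtain ⟨e, rfl⟩ := Nat.exists_eq_add_of_le hjK
  rw [Nat.add_sub_cancel_left]
  have hx : 0 < γ * ((F.L : ℝ)⁻¹) ^ e := mul_pos hγ (pow_pos (inv_pos.2 hL) e)
  have hβ : (F.scheme ℰp γ).β (j + e) = (F.L : ℝ) ^ j * (γ * ((F.L : ℝ)⁻¹) ^ e)⁻¹ := by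
    show (γ * ((F.L : ℝ)⁻¹) ^ (j + e))⁻¹ = _
    rw [pow_add, inv_pow, inv_pow, mul_inv, mul_inv, inv_inv]
    ring
  refine ⟨hβ, ?_⟩
  rw [hβ, θBal, mul_pow, Real.sq_sqrt hx.le]
  field_simp

end Arith

/-! ## §3 The stub's bound at every bounded height, uniformly in the volume and the run -/

section Tail

/-- ★★ **THE PER-PLAQUETTE TAIL OF THE BLOCK-AVERAGED FIELD AT BOUNDED HEIGHT, VOLUME- AND RUN-UNIFORM.**  For every `j₀`, block size `L` and profile
`0 < b₀`, `0 < p₀` there are `γ₁ ∈ (0,1]`, `C ≥ 0`, `c > 0`, `N` (depending on `L, b₀, p₀, j₀` only) such that for every family `F` with `F.L = L`, every `0 < γ ≤ γ₁`,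
every run `K`, every height `j ≤ min(K, j₀)` and every level-`j` plaquette `p`: `Gibbs_K{ θ_{b₀}(K−j) ≤ |Ū^j(∂p) − 1| } ≤ C·β_{K−j}^N·exp(−c·p_{b₀}(g_{K−j})²)`.
By §1 the event lies in the union over the `≤ B^j` blamed bare plaquettes `q` of `{θ_{b₀}(K−j)/(2W^j) ≤ |U(∂q) − 1|}` (`W = W₀ + 1`); the tree's bare tail and §2 give each
the mass `≤ 2e^{24}c₀⁻³(√β_K)^9 e^{−β_Kθ²/(16W^{2j})}` with `β_Kθ² = L^j p²`, `(√β_K)^9 ≤ β_K^5 = L^{5j}β_{K−j}^5`.  Witnesses `N = 5`, `c = (L/W²)^{j₀}/16`,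
`C = B^{j₀}·2e^{24}c₀⁻³·L^{5j₀}`.  The sibling `HistoryTailBoundedHeight.unitScaleTilt_perPlaquette_boundedHeight` has the same shape with a constant `∝ L^{3m}` (family-dependent).
[cite: Balaban1985UV3, (7) p.257, (11) p.258 and (71) p.273; Balaban1985Averaging, Prop. 1 (51) p.26] -/
theorem perPlaquette_boundedHeight_uniform (j₀ : ℕ) :
    ∀ (L : ℕ) (b₀ p₀ : ℝ), 0 < b₀ → 0 < p₀ → ∃ (γ₁ C c : ℝ) (N : ℕ), 0 < γ₁ ∧ γ₁ ≤ 1 ∧ 0 < c ∧ 0 ≤ C ∧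
      ∀ (F : T3Family) (γ : ℝ), F.L = L → 0 < γ → γ ≤ γ₁ → ∀ (K j : ℕ), j ≤ K → j ≤ j₀ → ∀ p : Plaq (F.P K) j,
        (gibbsK F ℰp γ K).real {U | θBal F.L γ b₀ p₀ (K - j) ≤ GaugeGroup.dist1 (GaugeField.plaqHol
            (Averaging.iter (fun i => BlockAveraging.blockAvg (P := F.P K) (j := i) ℰp) j U) p)} ≤
        C * ((γ * ((F.L : ℝ)⁻¹) ^ (K - j))⁻¹) ^ N * Real.exp (-(c * B10.pFun b₀ p₀ (Real.sqrt (γ * ((F.L : ℝ)⁻¹) ^ (K - j))) ^ 2)) := by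
  intro L b₀ p₀ hb₀ hp₀
  obtain ⟨c₀, hc₀, _hc₀1, htail⟩ := gibbsMeasure_real_dist1_ge_le (N := 2)
  by_cases hL : 1 ≤ L
  swap
  · refine ⟨1, 0, 1, 0, one_pos, le_rfl, one_pos, le_rfl, ?_⟩
    intro F γ hFL
    exact absurd (hFL ▸ le_of_lt F.hL.2) hL
  -- the constants
  set W₀ : ℝ := (L : ℝ) ^ 2 + 6 * (((3 + 2) * L : ℕ) : ℝ) ^ 2 with hW₀
  set W : ℝ := W₀ + 1 with hW
  set B : ℝ := (L : ℝ) ^ 2 + 5 * ((L : ℝ) ^ 3 * (3 : ℝ) ^ 2) with hB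
  have hW₀0 : 0 ≤ W₀ := by positivity
  have hW1 : 1 ≤ W := by linarith
  have hW0 : 0 < W := one_pos.trans_le hW1
  have hW₀W : W₀ ≤ W := by linarith
  have hB1 : 1 ≤ B := by
    have h1 : (1 : ℝ) ≤ (L : ℝ) ^ 2 := one_le_pow₀ (by exact_mod_cast hL)
    have h2 : (0 : ℝ) ≤ 5 * ((L : ℝ) ^ 3 * (3 : ℝ) ^ 2) := by positivity
    linarith
  have h5 : (0 : ℝ) < (((3 + 2) * L : ℕ) : ℝ) := by exact_mod_cast (by omega : 0 < (3 + 2) * L)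
  have hσ : 0 < deltaSU (Fin 2) / (((3 + 2) * L : ℕ) : ℝ) ^ 2 := div_pos deltaSU_pos (by positivity)
  obtain ⟨γθ, hγθ, hγθ1, hθ⟩ := exists_gamma_forall_θBal_le hb₀ hp₀ hσ
  have hL0 : (0 : ℝ) < L := by exact_mod_cast (by omega : 0 < L)
  have hL1 : (1 : ℝ) ≤ L := by exact_mod_cast hL
  refine ⟨γθ, B ^ j₀ * (2 * Real.exp 24 * (c₀ ^ 3)⁻¹) * (L : ℝ) ^ (5 * j₀),
    ((L : ℝ) / W ^ 2) ^ j₀ / 16, 5, hγθ, hγθ1, by positivity, by positivity, ?_⟩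
  intro F γ hFL hγ hγ₁ K j hjK hj₀ p
  subst hFL
  have hγ1 : γ ≤ 1 := hγ₁.trans hγθ1
  haveI := isProbabilityMeasure_gibbsK F ℰp hγ.le K
  have hPd : (F.P K).d = 3 := rfl
  have hPL : (F.P K).L = F.L := rfl
  have hjm : j ≤ (F.P K).m + (F.P K).K := by show j ≤ F.m + K; have := F.hm; omega
  -- threshold, blamed threshold
  set θ := θBal F.L γ b₀ p₀ (K - j) with hθdef
  have hθpos : 0 < θ := θBal_pos hL hγ hγ1 hb₀ p₀ (K - j)
  have hWj : 0 < W ^ j := pow_pos hW0 j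
  set a := θ / (2 * W ^ j) with hadef
  have ha : 0 < a := div_pos hθpos (by positivity)
  have hWja : W ^ j * a = θ / 2 := by rw [hadef]; field_simp
  -- the iterated blamed neighbourhood of `p`
  obtain ⟨S, hScard, hSdom⟩ := exists_blame_finset_iter (P := F.P K) j hjm p
  rw [hPd, hPL] at hScard hSdom
  push_cast at hScard
  -- the guard at every intermediate level: `W₀^i a ≤ θ/2 ≤ δ/(5L)²`
  have hWia : ∀ i, i ≤ j → W₀ ^ i * a ≤ θ / 2 := by
    intro i hi
    calc W₀ ^ i * a ≤ W ^ i * a := mul_le_mul_of_nonneg_right (pow_le_pow_left₀ hW₀0 hW₀W i) ha.le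
      _ ≤ W ^ j * a := mul_le_mul_of_nonneg_right (pow_le_pow_right₀ hW1 hi) ha.le
      _ = θ / 2 := hWja
  have hguard : ∀ i, i < j → (((3 + 2) * F.L : ℕ) : ℝ) ^ 2 / 4 * (W₀ ^ i * a) < deltaSU (Fin 2) := by
    intro i hi
    have hle : W₀ ^ i * a ≤ deltaSU (Fin 2) / (((3 + 2) * F.L : ℕ) : ℝ) ^ 2 :=
      (hWia i hi.le).trans ((half_le_self hθpos.le).trans (hθ F.L hL γ hγ hγ₁ (K - j)))
    calc (((3 + 2) * F.L : ℕ) : ℝ) ^ 2 / 4 * (W₀ ^ i * a)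
        ≤ (((3 + 2) * F.L : ℕ) : ℝ) ^ 2 / 4 * (deltaSU (Fin 2) / (((3 + 2) * F.L : ℕ) : ℝ) ^ 2) :=
          mul_le_mul_of_nonneg_left hle (by positivity)
      _ = deltaSU (Fin 2) / 4 := by field_simp
      _ < deltaSU (Fin 2) := by linarith [deltaSU_pos (n := Fin 2)]
  -- the event lies in the union of the blamed bare single-plaquette events
  have hsub : {U : GaugeField (F.P K) 0 (Matrix.specialUnitaryGroup (Fin 2) ℂ) |
        θBal F.L γ b₀ p₀ (K - j) ≤ dist1 (GaugeField.plaqHol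
          (Averaging.iter (fun i => BlockAveraging.blockAvg (P := F.P K) (j := i) ℰp) j U) p)} ⊆
      ⋃ q ∈ S, {U : GaugeField (F.P K) 0 (Matrix.specialUnitaryGroup (Fin 2) ℂ) | a ≤ dist1 (GaugeField.plaqHol U q)} := by
    intro U hlarge
    simp only [Set.mem_setOf_eq] at hlarge
    by_contra hcon
    simp only [Set.mem_iUnion, Set.mem_setOf_eq, not_exists, not_le] at hcon
    have hdom := hSdom U a ha.le hguard (fun q hq => (hcon q hq).le)
    have hlt : W₀ ^ j * a < θ := (hWia j le_rfl).trans_lt (half_lt_self hθpos)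
    exact absurd (hlarge.trans hdom) (not_le.mpr hlt)
  -- the bare tail at each blamed plaquette
  have hβ1 : 1 ≤ (F.scheme ℰp γ).β K := by
    show 1 ≤ (γ * (F.P K).eps)⁻¹
    have heps : (F.P K).eps = ((F.L : ℝ)⁻¹) ^ K := rfl
    rw [heps]
    have hx : 0 < γ * ((F.L : ℝ)⁻¹) ^ K := mul_pos hγ (pow_pos (inv_pos.2 hL0) K)
    have hx1 : γ * ((F.L : ℝ)⁻¹) ^ K ≤ 1 :=
      mul_le_one₀ hγ1 (pow_nonneg (inv_nonneg.2 (Nat.cast_nonneg _)) K)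
        (pow_le_one₀ (inv_nonneg.2 (Nat.cast_nonneg _)) (inv_le_one_of_one_le₀ hL1))
    exact (one_le_inv₀ hx).2 hx1
  obtain ⟨hβL, hβθ⟩ := beta_height F hγ b₀ p₀ hjK
  set β := (F.scheme ℰp γ).β K with hβdef
  set β' := (γ * ((F.L : ℝ)⁻¹) ^ (K - j))⁻¹ with hβ'def
  set pg := B10.pFun b₀ p₀ (Real.sqrt (γ * ((F.L : ℝ)⁻¹) ^ (K - j))) with hpgdef
  have hβ'0 : 0 ≤ β' := by rw [hβ'def]; positivity
  have hcard3 : Fintype.card {q : Fin (F.P K).d × Fin (F.P K).d // q.1 < q.2} = 3 := by rw [hPd]; decide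
  -- the uniform Gaussian constant: `(L/W²)^{j₀}/16 ≤ (L/W²)^j/16`
  have hratio0 : (0 : ℝ) ≤ (F.L : ℝ) / W ^ 2 := by positivity
  have hratio1 : (F.L : ℝ) / W ^ 2 ≤ 1 := by
    rw [div_le_one (by positivity)]
    have h1 : (F.L : ℝ) ≤ (F.L : ℝ) ^ 2 + 1 := by nlinarith only [hL1]
    have h2 : W ≤ W ^ 2 := by nlinarith only [hW1]
    have h3 : (F.L : ℝ) ^ 2 ≤ W₀ := by
      rw [hW₀]; exact le_add_of_nonneg_right (by positivity)
    have h4 : W = W₀ + 1 := hW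
    linarith only [h1, h2, h3, h4]
  have hexp_le : ∀ q : Plaq (F.P K) 0, Real.exp (-(β * a ^ 2 / (2 * (2 : ℕ)))) ≤
      Real.exp (-(((F.L : ℝ) / W ^ 2) ^ j₀ / 16 * pg ^ 2)) := by
    intro _
    refine Real.exp_le_exp.mpr (neg_le_neg ?_)
    have hβa : β * a ^ 2 / (2 * (2 : ℕ)) = ((F.L : ℝ) / W ^ 2) ^ j / 16 * pg ^ 2 := by
      have h1 : β * a ^ 2 = β * θ ^ 2 / (2 * W ^ j) ^ 2 := by rw [hadef, div_pow]; ring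
      rw [h1, hβθ, div_pow, ← pow_mul, show 2 * j = j * 2 by ring, pow_mul]
      push_cast
      field_simp
      ring
    rw [hβa]
    have hpow : ((F.L : ℝ) / W ^ 2) ^ j₀ ≤ ((F.L : ℝ) / W ^ 2) ^ j := pow_le_pow_of_le_one hratio0 hratio1 hj₀
    have h16 : ((F.L : ℝ) / W ^ 2) ^ j₀ / 16 ≤ ((F.L : ℝ) / W ^ 2) ^ j / 16 := by gcongr
    exact mul_le_mul_of_nonneg_right h16 (sq_nonneg _)
  have hterm : ∀ q : Plaq (F.P K) 0,
      (gibbsK F ℰp γ K).real {U | a ≤ dist1 (GaugeField.plaqHol U q)} ≤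
        2 * Real.exp 24 * (c₀ ^ 3)⁻¹ * ((F.L : ℝ) ^ (5 * j₀) * β' ^ 5) *
          Real.exp (-(((F.L : ℝ) / W ^ 2) ^ j₀ / 16 * pg ^ 2)) := by
    intro q
    have h := htail (F.P K) β hβ1 a ha.le q
    rw [gibbsK_eq]
    refine h.trans ?_
    rw [hcard3, hPd]
    -- the prefactor: `(√β)^9 ≤ β^5 = L^{5j} β'^5 ≤ L^{5j₀} β'^5`
    have hsqrt : Real.sqrt β ^ (3 * (2 ^ 2 - 1)) ≤ (F.L : ℝ) ^ (5 * j₀) * β' ^ 5 := by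
      rw [show 3 * (2 ^ 2 - 1) = 9 by norm_num]
      have hβ0 : 0 ≤ β := zero_le_one.trans hβ1
      have hs1 : Real.sqrt β ≤ β := by
        calc Real.sqrt β ≤ Real.sqrt β * Real.sqrt β :=
              le_mul_of_one_le_right (Real.sqrt_nonneg _) (Real.one_le_sqrt.mpr hβ1)
          _ = β := Real.mul_self_sqrt hβ0
      calc Real.sqrt β ^ 9 = (Real.sqrt β * Real.sqrt β) ^ 4 * Real.sqrt β := by ring
        _ = β ^ 4 * Real.sqrt β := by rw [Real.mul_self_sqrt hβ0]
        _ ≤ β ^ 4 * β := mul_le_mul_of_nonneg_left hs1 (pow_nonneg hβ0 4)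
        _ = β ^ 5 := by ring
        _ = ((F.L : ℝ) ^ j) ^ 5 * β' ^ 5 := by rw [hβL, mul_pow]
        _ = (F.L : ℝ) ^ (5 * j) * β' ^ 5 := by rw [← pow_mul, mul_comm j 5]
        _ ≤ (F.L : ℝ) ^ (5 * j₀) * β' ^ 5 :=
            mul_le_mul_of_nonneg_right (pow_le_pow_right₀ hL1 (by omega)) (pow_nonneg hβ'0 5)
    have hK0 : 0 ≤ 2 * Real.exp (8 * (3 : ℕ)) * (c₀ ^ 3)⁻¹ := by positivity
    have hpre0 : 0 ≤ 2 * Real.exp (8 * (3 : ℕ)) * (c₀ ^ 3)⁻¹ * ((F.L : ℝ) ^ (5 * j₀) * β' ^ 5) := by positivity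
    calc 2 * Real.exp (8 * (3 : ℕ)) * (c₀ ^ 3)⁻¹ * Real.sqrt β ^ (3 * (2 ^ 2 - 1)) * Real.exp (-(β * a ^ 2 / (2 * (2 : ℕ))))
        ≤ 2 * Real.exp (8 * (3 : ℕ)) * (c₀ ^ 3)⁻¹ * ((F.L : ℝ) ^ (5 * j₀) * β' ^ 5) *
            Real.exp (-(β * a ^ 2 / (2 * (2 : ℕ)))) :=
          mul_le_mul_of_nonneg_right (mul_le_mul_of_nonneg_left hsqrt hK0) (Real.exp_pos _).le
      _ ≤ 2 * Real.exp (8 * (3 : ℕ)) * (c₀ ^ 3)⁻¹ * ((F.L : ℝ) ^ (5 * j₀) * β' ^ 5) *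
            Real.exp (-(((F.L : ℝ) / W ^ 2) ^ j₀ / 16 * pg ^ 2)) :=
          mul_le_mul_of_nonneg_left (hexp_le q) hpre0
      _ = _ := by norm_num
  -- union bound over the `≤ B^j ≤ B^{j₀}` blamed plaquettes
  have hScard' : (S.card : ℝ) ≤ B ^ j₀ := by
    refine hScard.trans ?_
    exact pow_le_pow_right₀ hB1 hj₀
  have hT0 : 0 ≤ 2 * Real.exp 24 * (c₀ ^ 3)⁻¹ * ((F.L : ℝ) ^ (5 * j₀) * β' ^ 5) *
      Real.exp (-(((F.L : ℝ) / W ^ 2) ^ j₀ / 16 * pg ^ 2)) := by positivity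
  calc (gibbsK F ℰp γ K).real _
      ≤ (gibbsK F ℰp γ K).real (⋃ q ∈ S, {U : GaugeField (F.P K) 0 (Matrix.specialUnitaryGroup (Fin 2) ℂ) |
          a ≤ dist1 (GaugeField.plaqHol U q)}) := measureReal_mono hsub (measure_ne_top _ _)
    _ ≤ ∑ q ∈ S, (gibbsK F ℰp γ K).real {U | a ≤ dist1 (GaugeField.plaqHol U q)} := measureReal_biUnion_finset_le S _
    _ ≤ ∑ _q ∈ S, 2 * Real.exp 24 * (c₀ ^ 3)⁻¹ * ((F.L : ℝ) ^ (5 * j₀) * β' ^ 5) *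
          Real.exp (-(((F.L : ℝ) / W ^ 2) ^ j₀ / 16 * pg ^ 2)) := Finset.sum_le_sum fun q _ => hterm q
    _ = S.card * (2 * Real.exp 24 * (c₀ ^ 3)⁻¹ * ((F.L : ℝ) ^ (5 * j₀) * β' ^ 5) *
          Real.exp (-(((F.L : ℝ) / W ^ 2) ^ j₀ / 16 * pg ^ 2))) := by rw [Finset.sum_const, nsmul_eq_mul]
    _ ≤ B ^ j₀ * (2 * Real.exp 24 * (c₀ ^ 3)⁻¹ * ((F.L : ℝ) ^ (5 * j₀) * β' ^ 5) *
          Real.exp (-(((F.L : ℝ) / W ^ 2) ^ j₀ / 16 * pg ^ 2))) := mul_le_mul_of_nonneg_right hScard' hT0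
    _ = B ^ j₀ * (2 * Real.exp 24 * (c₀ ^ 3)⁻¹) * (F.L : ℝ) ^ (5 * j₀) * β' ^ 5 *
          Real.exp (-(((F.L : ℝ) / W ^ 2) ^ j₀ / 16 * pg ^ 2)) := by ring

/-- ★★ **`stub_firstExitDeep` AT EVERY BOUNDED HEIGHT, UNIFORMLY IN THE VOLUME AND THE RUN**: the registered stub's text (cruxes stmt-QuantumFields-22884 / 26243) with
the extra binder `j ≤ j₀` (and all heights `j ≤ K`, not only `j ≥ 2`), PROVED for every `j₀` — the first-exit event is contained in the plain large-plaquette event of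
`perPlaquette_boundedHeight_uniform`.  The stub is the case `j₀ = ∞`, NOT proved: the Gaussian constant `(L/W²)^{j₀}/16` degrades geometrically in the height.
[cite: Balaban1985UV3, (7) p.257 and (71) p.273] -/
theorem firstExitDeep_boundedHeight (j₀ : ℕ) :
    ∀ (L : ℕ) (b₀ p₀ b₂ : ℝ), 0 < b₀ → 2 < p₀ → b₀ ≤ b₂ → ∃ (γ₁ C c : ℝ) (N : ℕ), 0 < γ₁ ∧ γ₁ ≤ 1 ∧ 0 < c ∧ 0 ≤ C ∧
      ∀ (F : T3Family) (γ : ℝ), F.L = L → 0 < γ → γ ≤ γ₁ → ∀ (K j : ℕ), j ≤ K → j ≤ j₀ → ∀ p : Plaq (F.P K) j,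
        (gibbsK F ℰp γ K).real {U | (∀ k, k < j → PlaqSmall (θBal F.L γ b₀ p₀ (K - k))
            (Averaging.iter (fun i => BlockAveraging.blockAvg (P := F.P K) (j := i) ℰp) k U)) ∧
          PlaqSmall (θBal F.L γ b₂ p₀ (K - j)) (Averaging.iter (fun i => BlockAveraging.blockAvg (P := F.P K) (j := i) ℰp) j U) ∧
          θBal F.L γ b₀ p₀ (K - j) ≤ GaugeGroup.dist1 (GaugeField.plaqHol
            (Averaging.iter (fun i => BlockAveraging.blockAvg (P := F.P K) (j := i) ℰp) j U) p)} ≤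
        C * ((γ * ((F.L : ℝ)⁻¹) ^ (K - j))⁻¹) ^ N * Real.exp (-(c * B10.pFun b₀ p₀ (Real.sqrt (γ * ((F.L : ℝ)⁻¹) ^ (K - j))) ^ 2)) := by
  intro L b₀ p₀ b₂ hb₀ hp₀ _hb₂
  obtain ⟨γ₁, C, c, N, hγ₁, hγ₁1, hc, hC, h⟩ := perPlaquette_boundedHeight_uniform j₀ L b₀ p₀ hb₀ (by linarith)
  refine ⟨γ₁, C, c, N, hγ₁, hγ₁1, hc, hC, fun F γ hFL hγ hle K j hjK hj₀ p => ?_⟩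
  haveI := isProbabilityMeasure_gibbsK F ℰp hγ.le K
  exact (measureReal_mono (fun U hU => hU.2.2) (measure_ne_top _ _)).trans (h F γ hFL hγ hle K j hjK hj₀ p)

/-- ★ **THE UNIT-TOP TAIL FOR SHORT RUNS, UNIFORMLY IN THE VOLUME** («short runs are free»): for every `j₀`, `L`, `0 < b₀`, `2 < p₀` there are `γ₁, C, c, N` with, for every
family `F` (`F.L = L`), `0 < γ ≤ γ₁`, every run `K ≤ j₀` and unit plaquette `p`, `Gibbs_K{ sub-unit history θ_{b₀}-small ∧ θ_{b₀}(0) ≤ |Ū^K(∂p) − 1| } ≤ C·γ^{-N}·e^{−c·p_{b₀}(√γ)²}`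
— the companion normal form `UnitTop` (`…UnitTop.deepStub_iff_unitTop`) restricted to run lengths `≤ j₀`; its open content is `K → ∞`. [cite: Balaban1985UV3, (7) p.257 and (71) p.273] -/
theorem unitTop_boundedRuns (j₀ : ℕ) :
    ∀ (L : ℕ) (b₀ p₀ : ℝ), 0 < b₀ → 2 < p₀ → ∃ (γ₁ C c : ℝ) (N : ℕ), 0 < γ₁ ∧ γ₁ ≤ 1 ∧ 0 < c ∧ 0 ≤ C ∧
      ∀ (F : T3Family) (γ : ℝ), F.L = L → 0 < γ → γ ≤ γ₁ → ∀ (K : ℕ), K ≤ j₀ → ∀ p : Plaq (F.P K) K,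
        (gibbsK F ℰp γ K).real {U | (∀ k, k < K → PlaqSmall (θBal F.L γ b₀ p₀ (K - k))
            (Averaging.iter (fun i => BlockAveraging.blockAvg (P := F.P K) (j := i) ℰp) k U)) ∧
          θBal F.L γ b₀ p₀ 0 ≤ GaugeGroup.dist1 (GaugeField.plaqHol
            (Averaging.iter (fun i => BlockAveraging.blockAvg (P := F.P K) (j := i) ℰp) K U) p)} ≤
        C * (γ⁻¹) ^ N * Real.exp (-(c * B10.pFun b₀ p₀ (Real.sqrt γ) ^ 2)) := by
  intro L b₀ p₀ hb₀ hp₀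
  obtain ⟨γ₁, C, c, N, hγ₁, hγ₁1, hc, hC, h⟩ := perPlaquette_boundedHeight_uniform j₀ L b₀ p₀ hb₀ (by linarith)
  refine ⟨γ₁, C, c, N, hγ₁, hγ₁1, hc, hC, fun F γ hFL hγ hle K hK p => ?_⟩
  haveI := isProbabilityMeasure_gibbsK F ℰp hγ.le K
  have happ := h F γ hFL hγ hle K K le_rfl hK p
  simp only [Nat.sub_self, pow_zero, mul_one] at happ
  exact (measureReal_mono (fun U hU => hU.2) (measure_ne_top _ _)).trans happ

end Tail

end Summit.QuantumFields.YangMills.Theorems.FirstExitDeepBoundedHeight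

end
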